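import Summits.QuantumFields.BalabanUV.Beta.EriceFlowEnclosureCesaroClockHarmonic
import Summits.QuantumFields.BalabanUV.Beta.EriceFlowEnclosureLogMeanSeq

/-!
# Beta / EriceFlowEnclosureLogMeanClockIntegral — THE LOGARITHMIC CUTOFF SUM IS THE LOG-SCALE INTEGRAL, UP TO O(1) (service for «the two
# logarithmic averages are one», P2 #55b): for M C-log-Lipschitz, continuous and bounded by B on ]0, δ[ and L₀ > 0, the WEIGHTED ideal samples
# `M(L₀∕n)∕n` satisfy
#     **`|Σ_{n₀ ≤ n < N} M(L₀∕n)∕n − ∫_{L₀∕N}^{L₀∕n₀} M(s) ds∕s| ≤ 2(C + B)∕n₀`**   (n₀ ≥ 1, L₀∕n₀ < δ) — UNIFORM IN N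
# (the weighted cell error is `(C + B)∕n²`, SUMMABLE — contrast P2 #53i, where the unweighted cells `C∕n` add up to `C(1 + log N)`), the
# substitution `∫ₐᵇ M(L₀∕y) dy∕y = ∫_{L₀∕b}^{L₀∕a} M(s) ds∕s` (the measure `dy∕y = ds∕s` is scale invariant — this is WHY the logarithmic cutoff
# average and P2 #54j's log-scale average see the same thing), the boundary estimate `|∫ₐᵇ M ds∕s| ≤ B·log(b∕a)`, and the masses
# `log(N+1) ≤ H_N ≤ 1 + log N`, `H_N∕log N → 1` (Mathlib's harmonic bounds).  P2 #55b divides by `H_N ∼ log N ∼ log(c∕h_N)` along any two-loop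
# clock and concludes `(Σ_{n<N} M(h_n)∕(n+1))∕H_N − (∫_{h_N}^{c} M ds∕s)∕log(c∕h_N) → 0`.
# (β-flow team, prover 2 = lower ∕ positivity side, unit `b2b-balaban-beta-bflow-p2`, gen 38; module P2 #55a; pure [folklore]; no Erice sentence)

HONEST FRAMING (page 1 of everything the β sub-cell writes): discharging `BetaPertH` makes Bałaban's UV stability UNCONDITIONAL — a
real constructive-QFT result; it is NOT the continuum limit and NOT the Clay problem.  HONEST DEPENDENCY (cell reorg 2026-08-19,
verbatim): «continuum YM on T⁴ ⇐ BetaPertH ∧ nine spine estimates (0/9 proved); BetaPertH ⇐ (D1) ∧ (D4) ∧ CAP+tail; G-an2-4 gates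
asym, D1 and NE2/3/4.»  THIS MODULE DISCHARGES NOTHING and quotes nothing: [folklore] real analysis about a real function M (shape: the
three-loop Cesàro mean, bounded and log-Lipschitz by P2 #52a) — a weighted sum-versus-integral estimate, a change of variables, harmonic bounds
(Hardy, Divergent Series §§3.8, 4.16: the logarithmic method (ℓ) and the Riesz mean (R, log n, 1); by name over P2 #53i `comp_logLip` ∕
`comp_continuousOn` ∕ `integral_comp_div_eq` and Mathlib `log_add_one_le_harmonic` ∕ `harmonic_le_one_add_log`).

WHAT THIS FILE PROVES (0 sorry, 0 def): §1 `weightedCell_le` (`|M(L₀∕n)∕n − ∫ₙ^{n+1} M(L₀∕y) dy∕y| ≤ (C + B)∕n²`), `sum_inv_sub_inv_succ_eq`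
(telescoping), `sum_inv_sq_Ico_le` (`Σ_{n₀≤n<N} n⁻² ≤ 2∕n₀`), **`weightedSum_integral_le`**; §2 `integral_comp_div_div_eq` (the substitution),
HEADLINE **`weightedSum_logIntegral_le`** (the displayed inequality); §3 `integral_div_abs_le` (boundary); §4 `logMass_eq_harmonic`,
`log_succ_le_logMass`, `logMass_le_one_add_log`, **`logMass_div_log_tendsto_one`**.
NOT CLAIMED: the limit statement along a clock sequence (P2 #55b); anything about β; `BetaPertH`; continuum; Clay.
-/

namespace Summit.QuantumFields.BalabanUV.Beta.EriceFlowEnclosureLogMeanClockIntegral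

open Set Filter Topology MeasureTheory intervalIntegral
open Summit.QuantumFields.BalabanUV.Beta.EriceFlowEnclosureCesaroClockHarmonic (comp_logLip comp_continuousOn integral_comp_div_eq)

noncomputable section

variable {M : ℝ → ℝ} {δ C B L₀ : ℝ}

/-! ## §1 The weighted ideal samples `M(L₀∕n)∕n`: summable cell errors -/

/-- THE WEIGHTED CELL: for an integer `n ≥ 1` with `n > L₀∕δ`: **`|M(L₀∕n)∕n − ∫ₙ^{n+1} M(L₀∕y) dy∕y| ≤ (C + B)∕n²`** — on the cell
`M(L₀∕n)∕n − M(L₀∕y)∕y = (M(L₀∕n) − M(L₀∕y))∕y + M(L₀∕n)·(1∕n − 1∕y)`, the first within `C·log(y∕n)∕y ≤ C∕n²`, the second within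
`B·(1∕n − 1∕(n+1)) ≤ B∕n²`. [folklore] -/
theorem weightedCell_le (hδ : 0 < δ) (hL₀ : 0 < L₀) (hC : 0 ≤ C) (hcont : ContinuousOn M (Ioo 0 δ))
    (hlip : ∀ t u : ℝ, 0 < t → t ≤ u → u < δ → |M u - M t| ≤ C * Real.log (u / t))
    (hB : ∀ s ∈ Ioo 0 δ, |M s| ≤ B)
    {n : ℕ} (hn : 1 ≤ n) (hnδ : L₀ / δ < n) :
    |M (L₀ / n) / n - ∫ y in (n:ℝ)..(n:ℝ) + 1, M (L₀ / y) / y| ≤ (C + B) / (n:ℝ) ^ 2 := by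
  have hn0 : (0:ℝ) < n := by exact_mod_cast (lt_of_lt_of_le Nat.one_pos hn)
  have hLn : L₀ / n ∈ Ioo 0 δ := by
    refine ⟨div_pos hL₀ hn0, ?_⟩
    rw [div_lt_iff₀ hn0]; rw [div_lt_iff₀ hδ] at hnδ; linarith
  have hB0 : 0 ≤ B := (abs_nonneg _).trans (hB _ hLn)
  have hcont' : ContinuousOn (fun y => M (L₀ / y) / y) (Icc (n:ℝ) ((n:ℝ) + 1)) := by
    refine ((comp_continuousOn hδ hL₀ hcont).mono ?_).div continuousOn_id ?_
    · intro y hy; exact lt_of_lt_of_le hnδ hy.1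
    · intro y hy; exact (lt_of_lt_of_le hn0 hy.1).ne'
  have hint : IntervalIntegrable (fun y => M (L₀ / y) / y) volume (n:ℝ) ((n:ℝ) + 1) :=
    (hcont'.mono fun y hy => by rwa [uIcc_of_le (by linarith : (n:ℝ) ≤ n + 1)] at hy).intervalIntegrable
  have hconst : (∫ _y in (n:ℝ)..(n:ℝ) + 1, M (L₀ / n) / n) = M (L₀ / n) / n := by
    rw [intervalIntegral.integral_const]; simp
  rw [← hconst, ← intervalIntegral.integral_sub intervalIntegrable_const hint]
  have hbound : ∀ y ∈ Set.uIoc (n:ℝ) ((n:ℝ) + 1), ‖M (L₀ / n) / n - M (L₀ / y) / y‖ ≤ (C + B) / (n:ℝ) ^ 2 := by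
    intro y hy
    rw [uIoc_of_le (by linarith : (n:ℝ) ≤ n + 1)] at hy
    have hy0 : 0 < y := lt_trans hn0 hy.1
    have hny : (n:ℝ) ≤ y := hy.1.le
    have hdec : M (L₀ / n) / n - M (L₀ / y) / y
        = (M (L₀ / n) - M (L₀ / y)) / y + M (L₀ / n) * (1 / n - 1 / y) := by
      field_simp
      ring
    rw [Real.norm_eq_abs, hdec]
    have h1 : |(M (L₀ / n) - M (L₀ / y)) / y| ≤ C / (n:ℝ) ^ 2 := by
      rw [abs_div, abs_of_pos hy0, abs_sub_comm]
      have hl := comp_logLip hδ hL₀ hlip hnδ hny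
      have hlog : Real.log (y / n) ≤ (y - n) / n := by
        have := Real.log_le_sub_one_of_pos (div_pos hy0 hn0)
        rwa [div_sub_one hn0.ne'] at this
      calc |M (L₀ / y) - M (L₀ / n)| / y ≤ C * ((y - n) / n) / y :=
            div_le_div_of_nonneg_right (hl.trans (mul_le_mul_of_nonneg_left hlog hC)) hy0.le
        _ ≤ C / (n:ℝ) ^ 2 := by
            rw [div_le_div_iff₀ hy0 (by positivity)]
            have hkey : (y - n) * n ≤ y := by nlinarith [hy.2]
            calc C * ((y - n) / n) * (n:ℝ) ^ 2 = C * ((y - n) * n) := by field_simp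
              _ ≤ C * y := mul_le_mul_of_nonneg_left hkey hC
    have h2 : |M (L₀ / n) * (1 / n - 1 / y)| ≤ B / (n:ℝ) ^ 2 := by
      rw [abs_mul]
      have hd : 0 ≤ 1 / (n:ℝ) - 1 / y := by rw [sub_nonneg]; exact one_div_le_one_div_of_le hn0 hny
      rw [abs_of_nonneg hd]
      have hd2 : 1 / (n:ℝ) - 1 / y ≤ 1 / (n:ℝ) ^ 2 := by
        have hstep : 1 / (n:ℝ) - 1 / y ≤ 1 / n - 1 / (n + 1) := by
          have := one_div_le_one_div_of_le hy0 hy.2; linarith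
        refine hstep.trans ?_
        rw [div_sub_div _ _ hn0.ne' (by positivity), div_le_div_iff₀ (by positivity) (by positivity)]
        nlinarith
      calc |M (L₀ / n)| * (1 / n - 1 / y) ≤ B * (1 / (n:ℝ) ^ 2) := mul_le_mul (hB _ hLn) hd2 hd hB0
        _ = B / (n:ℝ) ^ 2 := by ring
    calc |(M (L₀ / ↑n) - M (L₀ / y)) / y + M (L₀ / ↑n) * (1 / ↑n - 1 / y)|
        ≤ C / (n:ℝ) ^ 2 + B / (n:ℝ) ^ 2 := (abs_add_le _ _).trans (add_le_add h1 h2)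
      _ = (C + B) / (n:ℝ) ^ 2 := by ring
  have h := intervalIntegral.norm_integral_le_of_norm_le_const hbound
  rw [Real.norm_eq_abs] at h
  simpa using h

/-- Telescoping: `Σ_{n₀ ≤ n < N} (1∕n − 1∕(n+1)) = 1∕n₀ − 1∕N` for `n₀ ≤ N`. [folklore] -/
theorem sum_inv_sub_inv_succ_eq {n₀ N : ℕ} (hN : n₀ ≤ N) :
    ∑ n ∈ Finset.Ico n₀ N, (1 / (n:ℝ) - 1 / ((n:ℝ) + 1)) = 1 / (n₀:ℝ) - 1 / (N:ℝ) := by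
  induction N, hN using Nat.le_induction with
  | base => simp
  | succ N hN ih =>
    rw [Finset.sum_Ico_succ_top hN, ih]
    push_cast
    ring

/-- `Σ_{n₀ ≤ n < N} 1∕n² ≤ 2∕n₀` for `n₀ ≥ 1` (`1∕n² ≤ 2∕(n(n+1))`, then telescoping). [folklore] -/
theorem sum_inv_sq_Ico_le {n₀ N : ℕ} (hn₀ : 1 ≤ n₀) :
    ∑ n ∈ Finset.Ico n₀ N, 1 / (n:ℝ) ^ 2 ≤ 2 / (n₀:ℝ) := by
  rcases le_or_gt n₀ N with hN | hN
  · calc ∑ n ∈ Finset.Ico n₀ N, 1 / (n:ℝ) ^ 2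
        ≤ ∑ n ∈ Finset.Ico n₀ N, 2 * (1 / (n:ℝ) - 1 / ((n:ℝ) + 1)) := by
          refine Finset.sum_le_sum fun n hn => ?_
          have hn1 : (1:ℝ) ≤ n := by exact_mod_cast hn₀.trans (Finset.mem_Ico.mp hn).1
          have hn0 : (0:ℝ) < n := by linarith
          have e : 2 * (1 / (n:ℝ) - 1 / ((n:ℝ) + 1)) = 2 / ((n:ℝ) * ((n:ℝ) + 1)) := by
            field_simp
            ring
          rw [e, div_le_div_iff₀ (by positivity) (by positivity)]
          nlinarith [mul_nonneg hn0.le (sub_nonneg.mpr hn1)]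
      _ = 2 * (1 / (n₀:ℝ) - 1 / (N:ℝ)) := by rw [← Finset.mul_sum, sum_inv_sub_inv_succ_eq hN]
      _ ≤ 2 / (n₀:ℝ) := by
          have : (0:ℝ) ≤ 1 / (N:ℝ) := by positivity
          have e : 2 / (n₀:ℝ) = 2 * (1 / (n₀:ℝ)) := by ring
          rw [e]; linarith
  · rw [Finset.Ico_eq_empty (by omega), Finset.sum_empty]; positivity

/-- **THE WEIGHTED SUM IS THE INTEGRAL UP TO A SUMMABLE ERROR**: for `1 ≤ n₀ ≤ N` with `L₀∕δ < n₀`: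
**`|Σ_{n₀ ≤ n < N} M(L₀∕n)∕n − ∫_{n₀}^{N} M(L₀∕y) dy∕y| ≤ 2(C + B)∕n₀`** — uniformly in N. [folklore] -/
theorem weightedSum_integral_le (hδ : 0 < δ) (hL₀ : 0 < L₀) (hC : 0 ≤ C) (hcont : ContinuousOn M (Ioo 0 δ))
    (hlip : ∀ t u : ℝ, 0 < t → t ≤ u → u < δ → |M u - M t| ≤ C * Real.log (u / t))
    (hB : ∀ s ∈ Ioo 0 δ, |M s| ≤ B)
    {n₀ N : ℕ} (hn₀ : 1 ≤ n₀) (hn₀δ : L₀ / δ < n₀) (hN : n₀ ≤ N) :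
    |∑ n ∈ Finset.Ico n₀ N, M (L₀ / n) / n - ∫ y in (n₀:ℝ)..(N:ℝ), M (L₀ / y) / y| ≤ 2 * (C + B) / n₀ := by
  have hn₀0 : (0:ℝ) < n₀ := by exact_mod_cast lt_of_lt_of_le Nat.one_pos hn₀
  have hLn₀ : L₀ / n₀ ∈ Ioo 0 δ := by
    refine ⟨div_pos hL₀ hn₀0, ?_⟩
    rw [div_lt_iff₀ hn₀0]; rw [div_lt_iff₀ hδ] at hn₀δ; linarith
  have hB0 : 0 ≤ B := (abs_nonneg _).trans (hB _ hLn₀)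
  -- the integral as a sum of cell integrals
  have hcells : ∑ n ∈ Finset.Ico n₀ N, (∫ y in (n:ℝ)..(n:ℝ) + 1, M (L₀ / y) / y)
      = ∫ y in (n₀:ℝ)..(N:ℝ), M (L₀ / y) / y := by
    have h := intervalIntegral.sum_integral_adjacent_intervals_Ico (a := fun k : ℕ => (k : ℝ)) (μ := volume)
      (f := fun y => M (L₀ / y) / y) hN ?_
    · simpa [Nat.cast_add, Nat.cast_one] using h
    · intro k hk
      have hk1 : L₀ / δ < k := lt_of_lt_of_le hn₀δ (by exact_mod_cast hk.1)
      have hk0 : (0:ℝ) < k := by exact_mod_cast lt_of_lt_of_le Nat.one_pos (hn₀.trans hk.1)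
      have hkk : (k:ℝ) ≤ ((k + 1 : ℕ) : ℝ) := by push_cast; linarith
      refine (ContinuousOn.div ((comp_continuousOn hδ hL₀ hcont).mono ?_) continuousOn_id ?_).intervalIntegrable
      · intro y hy; rw [uIcc_of_le hkk] at hy; exact lt_of_lt_of_le hk1 hy.1
      · intro y hy; rw [uIcc_of_le hkk] at hy; exact (lt_of_lt_of_le hk0 hy.1).ne'
  rw [← hcells, ← Finset.sum_sub_distrib]
  calc _ ≤ ∑ n ∈ Finset.Ico n₀ N, |M (L₀ / n) / n - ∫ y in (n:ℝ)..(n:ℝ) + 1, M (L₀ / y) / y| :=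
        Finset.abs_sum_le_sum_abs _ _
    _ ≤ ∑ n ∈ Finset.Ico n₀ N, (C + B) / (n:ℝ) ^ 2 := Finset.sum_le_sum fun n hn => by
        obtain ⟨h1, _⟩ := Finset.mem_Ico.mp hn
        exact weightedCell_le hδ hL₀ hC hcont hlip hB (hn₀.trans h1) (lt_of_lt_of_le hn₀δ (by exact_mod_cast h1))
    _ = (C + B) * ∑ n ∈ Finset.Ico n₀ N, 1 / (n:ℝ) ^ 2 := by
        rw [Finset.mul_sum]; exact Finset.sum_congr rfl fun n _ => by ring
    _ ≤ (C + B) * (2 / n₀) := mul_le_mul_of_nonneg_left (sum_inv_sq_Ico_le hn₀) (by linarith)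
    _ = 2 * (C + B) / n₀ := by ring

/-! ## §2 The substitution s = L₀∕y: `dy∕y = ds∕s` -/

/-- **THE SCALE-INVARIANT SUBSTITUTION**: `∫ₐᵇ M(L₀∕y) dy∕y = ∫_{L₀∕b}^{L₀∕a} M(s) ds∕s` for `0 < a ≤ b` with `L₀∕a < δ` (P2 #53i
`integral_comp_div_eq` applied to `G(s) = s·M(s)`: `G(L₀∕y) = L₀·M(L₀∕y)∕y` and `G(s)∕s² = M(s)∕s`). [folklore] -/
theorem integral_comp_div_div_eq (hL₀ : 0 < L₀) (hcont : ContinuousOn M (Ioo 0 δ))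
    {a b : ℝ} (ha : 0 < a) (hab : a ≤ b) (haδ : L₀ / a < δ) :
    ∫ y in a..b, M (L₀ / y) / y = ∫ s in (L₀ / b)..(L₀ / a), M s / s := by
  have hb : 0 < b := ha.trans_le hab
  have hG : ContinuousOn (fun s => s * M s) (Ioo 0 δ) := continuousOn_id.mul hcont
  have h1 : ∫ y in a..b, M (L₀ / y) / y = L₀⁻¹ * ∫ y in a..b, (fun s => s * M s) (L₀ / y) := by
    rw [← intervalIntegral.integral_const_mul]
    refine intervalIntegral.integral_congr fun y hy => ?_
    have hy0 : y ≠ 0 := by rw [uIcc_of_le hab] at hy; exact (ha.trans_le hy.1).ne'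
    simp only
    field_simp
  rw [h1, integral_comp_div_eq hL₀ hG ha hab haδ, ← mul_assoc, inv_mul_cancel₀ hL₀.ne', one_mul]
  refine intervalIntegral.integral_congr fun s hs => ?_
  have hs0 : s ≠ 0 := by
    rw [uIcc_of_le (div_le_div_of_nonneg_left hL₀.le ha hab)] at hs
    exact ((div_pos hL₀ hb).trans_le hs.1).ne'
  field_simp

/-- **THE LOGARITHMIC CUTOFF SUM IS THE LOG-SCALE INTEGRAL (HEADLINE)**: for `1 ≤ n₀ ≤ N` with `L₀∕n₀ < δ`:
**`|Σ_{n₀ ≤ n < N} M(L₀∕n)∕n − ∫_{L₀∕N}^{L₀∕n₀} M(s) ds∕s| ≤ 2(C + B)∕n₀`** — uniformly in N. [folklore] -/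
theorem weightedSum_logIntegral_le (hδ : 0 < δ) (hL₀ : 0 < L₀) (hC : 0 ≤ C) (hcont : ContinuousOn M (Ioo 0 δ))
    (hlip : ∀ t u : ℝ, 0 < t → t ≤ u → u < δ → |M u - M t| ≤ C * Real.log (u / t))
    (hB : ∀ s ∈ Ioo 0 δ, |M s| ≤ B)
    {n₀ N : ℕ} (hn₀ : 1 ≤ n₀) (hn₀δ : L₀ / n₀ < δ) (hN : n₀ ≤ N) :
    |∑ n ∈ Finset.Ico n₀ N, M (L₀ / n) / n - ∫ s in (L₀ / N)..(L₀ / n₀), M s / s| ≤ 2 * (C + B) / n₀ := by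
  have hn₀0 : (0:ℝ) < n₀ := by exact_mod_cast lt_of_lt_of_le Nat.one_pos hn₀
  have hn₀δ' : L₀ / δ < n₀ := by
    rw [div_lt_iff₀ hδ]; rw [div_lt_iff₀ hn₀0] at hn₀δ; linarith
  rw [← integral_comp_div_div_eq hL₀ hcont hn₀0 (by exact_mod_cast hN) hn₀δ]
  exact weightedSum_integral_le hδ hL₀ hC hcont hlip hB hn₀ hn₀δ' hN

/-! ## §3 The boundary estimate -/

/-- `|∫ₐᵇ M(s) ds∕s| ≤ B·log(b∕a)` for `0 < a ≤ b < δ` and |M| ≤ B on ]0, δ[ (no integrability needed). [folklore] -/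
theorem integral_div_abs_le (hB : ∀ s ∈ Ioo 0 δ, |M s| ≤ B) {a b : ℝ} (ha : 0 < a) (hab : a ≤ b) (hbδ : b < δ) :
    |∫ s in a..b, M s / s| ≤ B * Real.log (b / a) := by
  have hbound : ∀ s ∈ Set.Ioc a b, ‖M s / s‖ ≤ B * s⁻¹ := by
    intro s hs
    have hs0 : 0 < s := lt_of_lt_of_le ha hs.1.le
    rw [Real.norm_eq_abs, abs_div, abs_of_pos hs0, div_eq_mul_inv]
    exact mul_le_mul_of_nonneg_right (hB s ⟨hs0, lt_of_le_of_lt hs.2 hbδ⟩) (by positivity)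
  have hint : IntervalIntegrable (fun s : ℝ => B * s⁻¹) volume a b :=
    (intervalIntegral.intervalIntegrable_inv (fun s hs => by
      rw [uIcc_of_le hab] at hs; exact (lt_of_lt_of_le ha hs.1).ne') continuousOn_id).const_mul B
  have h := intervalIntegral.norm_integral_le_of_norm_le (μ := volume) (f := fun s => M s / s) hab
    (Filter.Eventually.of_forall fun s => by
      by_cases hs : s ∈ Set.Ioc a b
      · exact fun _ => hbound s hs
      · exact fun h' => absurd h' hs) hint
  rw [Real.norm_eq_abs, intervalIntegral.integral_const_mul, integral_inv_of_pos ha (lt_of_lt_of_le ha hab)] at h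
  exact h

/-! ## §4 The masses: `log(N+1) ≤ H_N ≤ 1 + log N` -/

/-- The lineage's logarithmic mass `H_N = Σ_{n<N} (n+1)⁻¹` is Mathlib's `harmonic N`. [folklore] -/
theorem logMass_eq_harmonic (N : ℕ) : (harmonic N : ℝ) = ∑ n ∈ Finset.range N, ((n : ℝ) + 1)⁻¹ := by
  simp [harmonic]

/-- `log(N+1) ≤ H_N` (Mathlib `log_add_one_le_harmonic`). [folklore] -/
theorem log_succ_le_logMass (N : ℕ) : Real.log ((N : ℝ) + 1) ≤ ∑ n ∈ Finset.range N, ((n : ℝ) + 1)⁻¹ := by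
  have h := log_add_one_le_harmonic N
  rw [logMass_eq_harmonic] at h
  push_cast at h
  exact h

/-- `H_N ≤ 1 + log N` (Mathlib `harmonic_le_one_add_log`). [folklore] -/
theorem logMass_le_one_add_log (N : ℕ) : ∑ n ∈ Finset.range N, ((n : ℝ) + 1)⁻¹ ≤ 1 + Real.log N := by
  have h := harmonic_le_one_add_log N
  rwa [logMass_eq_harmonic] at h

/-- **`H_N∕log N → 1`** (`1 ≤ H_N∕log N ≤ 1 + 1∕log N` for N ≥ 2). [folklore] -/
theorem logMass_div_log_tendsto_one :
    Tendsto (fun N : ℕ => (∑ n ∈ Finset.range N, ((n : ℝ) + 1)⁻¹) / Real.log N) atTop (𝓝 1) := by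
  have hlog : Tendsto (fun N : ℕ => Real.log (N:ℝ)) atTop atTop :=
    Real.tendsto_log_atTop.comp tendsto_natCast_atTop_atTop
  have hup : Tendsto (fun N : ℕ => 1 + 1 / Real.log (N:ℝ)) atTop (𝓝 1) := by
    have h := (tendsto_const_nhds (x := (1:ℝ))).div_atTop hlog
    have := (tendsto_const_nhds (x := (1:ℝ))).add h
    rwa [add_zero] at this
  refine tendsto_of_tendsto_of_tendsto_of_le_of_le' tendsto_const_nhds hup ?_ ?_
  · filter_upwards [eventually_ge_atTop 2] with N hN
    have hN' : (2:ℝ) ≤ N := by exact_mod_cast hN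
    have hlogpos : 0 < Real.log (N:ℝ) := Real.log_pos (by linarith)
    rw [le_div_iff₀ hlogpos, one_mul]
    exact (Real.log_le_log (by linarith) (by linarith : (N:ℝ) ≤ N + 1)).trans (log_succ_le_logMass N)
  · filter_upwards [eventually_ge_atTop 2] with N hN
    have hN' : (2:ℝ) ≤ N := by exact_mod_cast hN
    have hlogpos : 0 < Real.log (N:ℝ) := Real.log_pos (by linarith)
    rw [div_le_iff₀ hlogpos, add_mul, one_mul, div_mul_cancel₀ _ hlogpos.ne']
    linarith [logMass_le_one_add_log N]

end

end Summit.QuantumFields.BalabanUV.Beta.EriceFlowEnclosureLogMeanClockIntegral
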